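import Literature.Barriers.RiemannHypothesis.EpsteinZetaRealZeroLocated
import Literature.Barriers.RiemannHypothesis.EpsteinZetaCentralZero
import HarnessLib

/-!
# The real zeros of the Epstein zeta functions of binary forms fill the open interval `(0, 1)`

Proof file (no definitions; everything is proved) in the series attached to the barrier
`Literature/Barriers/RiemannHypothesis/EpsteinZetaRealZeros.lean`
(`Literature.Barriers.RiemannHypothesis.EpsteinZetaRealZeros`), barrier audit of generation 7
(D-0021) of the discharge file `EpsteinZetaRealZerosProofs.lean`; it continues
`EpsteinZetaCentralZero.lean` (a member of the family with a double zero AT `s = ½`).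

**Main theorem (`realZeros_fill_unit_interval`).** For EVERY real `β ∈ (0, 1)` there is `c > 1` such
that every analytic continuation `Z` of the Epstein zeta function of the positive definite form
`x² + cy²` vanishes at `β`. So the set of real zeros in `[0, 1]` realised by the family
`{ζ_Q : Q positive definite real binary}` is exactly `(0, 1)` (no member vanishes at `0`, where
`ζ_Q(0) = −1`, nor at the pole `1`), and NO sub-interval of `(0, 1)`, however short and wherever
placed, is free of zeros of every `ζ_Q`: a zero-free real interval for `ζ_K = ζ·L(s, χ_d)` (or for
`ζ`) cannot follow from the structure shared by all `ζ_Q` — functional equation, theta series,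
constant-term / Chowla–Selberg expansion, class-by-class treatment. The printed obstruction
(Bateman–Grosswald: a zero SOMEWHERE in `(½, 1)` once `k > 7.0556`; Stark: near `1` for large `k`;
the tree's `exists_realZero_located`: inside `(1 − 4/k, 1 − 1/(5k))` for `k ≥ 50`) is thereby
completed to every prescribed position. Numerically this is the real branch of off-critical zeros
of Bétermin–Šamaj–Travěnec (§4.2: born at the edge zero `Δ*_c`, `ρ_x = ½`, and tending to the
borders `0` and `1`).

## The proof

Fix `β ∈ (½, 1)` and move the form along the rectangular family `z = iy`, `y ≥ 1`.
(1) `z ↦ Λ_z(β)` is continuous on the horizontal strips `{1 ≤ Im z ≤ Y}`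
(`continuousOn_thetaΛ_ofReal`): by the decomposition
`Λ_z(s) = 2y^sΛ(2s) + 2y^{1−s}Λ(2−2s) + E_z(s)` of `EpsteinZetaConstantTerms.lean` it suffices
that `z ↦ E_z(s) = ∫₁^∞ (t^{s−1} + t^{−s}) R_z(t) dt` is continuous, which is dominated convergence
(`continuousOn_mellin_thetaRemainderTop`): `z ↦ R_z(t)` is continuous (`z ↦ Θ_z(t)` is, by
`ModularEisensteinContinuation.continuous_thetaQ_left`), and on the strip
`|R_z(t)| ≤ 12√Y t e^{−t} ≤ 12√Y t²e^{−t}` (`t ≥ 1`), an integrable majorant.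
(2) At `y = 1`, `Λ_z(β) < 0` (`EpsteinZetaRealZerosNearOne.re_thetaΛ_neg_of_im_le_one`).
(3) At a large height `Y` (`exists_im_re_thetaΛ_pos`), `Λ_{z}(β) > 0`: with
`A = 1/(2β−1) − 1/(2β) ≤ Λ(2β)`, `−B = −1/(2−2β) − 1/(2β−1) ≤ Λ(2−2β)` and `|E_z| ≤ 2` (`Y ≥ 50`),
`Λ_z(β) ≥ 2Y^βA − 2Y^{1−β}B − 2 > 0` as soon as `Y^{2β−1} ≥ 2(B+1)/A`.
(4) The intermediate value theorem along the continuous path `y ↦ iy` gives `y⋆ ∈ (1, Y)` with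
`Λ_{iy⋆}(β) = 0`, whence `Z(β) = 0` for every continuation of `ζ_Q`, `Q ~ x² + y⋆²y²`
(`EpsteinZetaCentralValue.continuation_ofReal_eq`). For `β ∈ (0, ½)` use `Λ_z(1 − s) = Λ_z(s)`;
`β = ½` is `EpsteinZetaCentralZero.exists_form_central_zero`.

## References

* [BatemanGrosswald1964] P. T. Bateman, E. Grosswald, *On Epstein's zeta function*, Acta Arith. 9
  (1964) 365–373, Theorem 1 (3)–(5) (the decomposition), Theorem 3.
* [Stark1967EpsteinZeros] H. M. Stark, *On the zeros of Epstein's zeta function*, Mathematika 14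
  (1967) 47–55, Theorem 1 and §4 (the real pair "between `0` and `1`").
* [BeterminSamajTravenec2021] L. Bétermin, L. Šamaj, I. Travěnec, *Interplay between critical and
  off-critical zeros of two-dimensional Epstein zeta functions*, arXiv:2110.09368, §4.2 (the real
  off-critical branch `ρ_x(Δ)` from `½` at `Δ*_c` to the borders `0`, `1`; numerics) (read).
-/

noncomputable section

open Complex Filter Topology MeasureTheory Set HurwitzZeta Asymptotics
open scoped UpperHalfPlane

namespace Literature.Barriers.RiemannHypothesis

open Literature.NumberTheory.Automorphic

/-! ## Continuity of the remainder `R_z(t)` in `z` -/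

/-- **`z ↦ R_z(t)` is continuous** (`t > 0`): `R_z(t) = Θ_z(t) − ϑ(t/y) − √(y/t)(ϑ(yt) − 1)` with
`z ↦ Θ_z(t)` continuous and `ϑ` continuous on `(0, ∞)`. [folklore] -/
theorem continuous_thetaRemainder_left {t : ℝ} (ht : 0 < t) :
    Continuous fun z : ℍ => thetaRemainder z t := by
  have h1 : Continuous fun z : ℍ => (thetaQ z t : ℂ) :=
    Complex.continuous_ofReal.comp (continuous_thetaQ_left ht)
  have him : Continuous fun z : ℍ => z.im := UpperHalfPlane.continuous_im
  have h2 : Continuous fun z : ℍ => evenKernel 0 (t / z.im) :=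
    (continuousOn_evenKernel 0).comp_continuous (continuous_const.div him fun z => z.im_pos.ne')
      fun z => div_pos ht z.im_pos
  have h3 : Continuous fun z : ℍ => evenKernel 0 (z.im * t) :=
    (continuousOn_evenKernel 0).comp_continuous (him.mul continuous_const) fun z => mul_pos z.im_pos ht
  have h4 : Continuous fun z : ℍ => Real.sqrt (z.im / t) := (him.div_const t).sqrt
  show Continuous fun z : ℍ => (thetaQ z t : ℂ) - (evenKernel 0 (t / z.im) : ℂ) -
    (Real.sqrt (z.im / t) : ℂ) * ((evenKernel 0 (z.im * t) : ℂ) - 1)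
  exact (h1.sub (Complex.continuous_ofReal.comp h2)).sub
    ((Complex.continuous_ofReal.comp h4).mul ((Complex.continuous_ofReal.comp h3).sub continuous_const))

/-! ## Continuity of the Bessel part `E_z(s)` in `z` (dominated convergence) -/

/-- **A majorant uniform on the strip `1 ≤ Im z ≤ Y`**: `|R_z(t)| ≤ 12√Y · t²e^{−t}` for `t ≥ 1`
(from `|R_z(t)| ≤ 12√y e^{−1.4πy} te^{−t}`). [folklore] -/
theorem norm_thetaRemainder_le_unif {Y : ℝ} {z : ℍ} (hz1 : 1 ≤ z.im) (hzY : z.im ≤ Y) {t : ℝ}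
    (ht : 1 ≤ t) : ‖thetaRemainder z t‖ ≤ 12 * Real.sqrt Y * (Real.exp (-t) * t ^ 2) := by
  refine (norm_thetaRemainder_le_of_one_le z hz1 ht).trans ?_
  have hsq : Real.sqrt z.im ≤ Real.sqrt Y := Real.sqrt_le_sqrt hzY
  have hexp : Real.exp (-(7 / 5) * Real.pi * z.im) ≤ 1 :=
    Real.exp_le_one_iff.2 (by nlinarith [Real.pi_pos])
  have hE := Real.exp_pos (-t)
  have ht2 : t ≤ t ^ 2 := by nlinarith
  have htt : t * Real.exp (-t) ≤ Real.exp (-t) * t ^ 2 := by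
    rw [mul_comm]
    exact mul_le_mul_of_nonneg_left ht2 hE.le
  have h0 : 0 ≤ 12 * Real.sqrt z.im := by positivity
  calc 12 * Real.sqrt z.im * Real.exp (-(7 / 5) * Real.pi * z.im) * (t * Real.exp (-t))
      ≤ 12 * Real.sqrt Y * 1 * (Real.exp (-t) * t ^ 2) := by gcongr
    _ = 12 * Real.sqrt Y * (Real.exp (-t) * t ^ 2) := by ring

/-- **`z ↦ ∫₁^∞ R_z(t) t^{s−1} dt` is continuous on `{1 ≤ Im z ≤ Y}`** for `Re s ≤ 1`: dominated
convergence with the majorant `12√Y t²e^{−t}` (`t^{Re s − 1} ≤ 1` on `t ≥ 1`). [folklore] -/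
theorem continuousOn_mellin_thetaRemainderTop {s : ℂ} (hs : s.re ≤ 1) (Y : ℝ) :
    ContinuousOn (fun z : ℍ => mellin (thetaRemainderTop z) s) {z : ℍ | 1 ≤ z.im ∧ z.im ≤ Y} := by
  show ContinuousOn (fun z : ℍ => ∫ t in Ioi (0 : ℝ), ((t : ℂ) ^ (s - 1)) • thetaRemainderTop z t)
    {z : ℍ | 1 ≤ z.im ∧ z.im ≤ Y}
  have hbint : Integrable (fun t : ℝ => 12 * Real.sqrt Y * (Real.exp (-t) * t ^ 2))
      (volume.restrict (Ioi 0)) :=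
    integrableOn_exp_neg_mul_sq.integrable.const_mul _
  refine continuousOn_of_dominated (bound := fun t : ℝ => 12 * Real.sqrt Y * (Real.exp (-t) * t ^ 2))
    (fun z hz => ?_) (fun z hz => ?_) hbint ?_
  · exact (mellinConvergent_thetaRemainderTop z hz.1 s).integrable.aestronglyMeasurable
  · filter_upwards [ae_restrict_mem measurableSet_Ioi] with t ht
    have ht0 : (0 : ℝ) < t := ht
    by_cases h1 : t ∈ Ioi (1 : ℝ)
    · have ht1 : (1 : ℝ) < t := h1
      rw [thetaRemainderTop, Set.indicator_of_mem h1, norm_smul,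
        Complex.norm_cpow_eq_rpow_re_of_pos ht0, Complex.sub_re, Complex.one_re]
      have hpow : t ^ (s.re - 1) ≤ 1 := Real.rpow_le_one_of_one_le_of_nonpos ht1.le (by linarith)
      have hR := norm_thetaRemainder_le_unif hz.1 hz.2 ht1.le
      have hR0 : 0 ≤ ‖thetaRemainder z t‖ := norm_nonneg _
      calc t ^ (s.re - 1) * ‖thetaRemainder z t‖ ≤ 1 * ‖thetaRemainder z t‖ :=
            mul_le_mul_of_nonneg_right hpow hR0
        _ ≤ 12 * Real.sqrt Y * (Real.exp (-t) * t ^ 2) := by rw [one_mul]; exact hR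
    · rw [thetaRemainderTop, Set.indicator_of_notMem h1, smul_zero, norm_zero]
      positivity
  · filter_upwards with t
    by_cases h1 : t ∈ Ioi (1 : ℝ)
    · have ht0 : (0 : ℝ) < t := lt_trans one_pos h1
      have hc := continuous_thetaRemainder_left ht0
      have e : (fun z : ℍ => ((t : ℂ) ^ (s - 1)) • thetaRemainderTop z t) =
          fun z : ℍ => ((t : ℂ) ^ (s - 1)) • thetaRemainder z t := by
        funext z
        rw [thetaRemainderTop, Set.indicator_of_mem h1]
      rw [e]
      exact (hc.const_smul ((t : ℂ) ^ (s - 1))).continuousOn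
    · have e : (fun z : ℍ => ((t : ℂ) ^ (s - 1)) • thetaRemainderTop z t) = fun _ => 0 := by
        funext z
        rw [thetaRemainderTop, Set.indicator_of_notMem h1, smul_zero]
      rw [e]
      exact continuousOn_const

/-- **`z ↦ E_z(s)` is continuous on `{1 ≤ Im z ≤ Y}`** for `0 ≤ Re s ≤ 1`. [folklore] -/
theorem continuousOn_epsteinBesselPart {s : ℂ} (h0 : 0 ≤ s.re) (h1 : s.re ≤ 1) (Y : ℝ) :
    ContinuousOn (fun z : ℍ => epsteinBesselPart z s) {z : ℍ | 1 ≤ z.im ∧ z.im ≤ Y} := by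
  unfold epsteinBesselPart
  exact (continuousOn_mellin_thetaRemainderTop h1 Y).add
    (continuousOn_mellin_thetaRemainderTop (s := 1 - s)
      (by simp only [Complex.sub_re, Complex.one_re]; linarith) Y)

/-- **`z ↦ Λ_z(σ)` is continuous on `{1 ≤ Im z ≤ Y}`** for real `σ ∈ (0, 1)`, `σ ≠ ½`
(`Λ_z(σ) = 2y^σΛ(2σ) + 2y^{1−σ}Λ(2−2σ) + E_z(σ)`, `y = Im z`).
[cite: BatemanGrosswald1964, Theorem 1 (3)–(5)] -/
theorem continuousOn_thetaΛ_ofReal {σ : ℝ} (h0 : 0 < σ) (h1 : σ < 1) (hh : σ ≠ 1 / 2) (Y : ℝ) :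
    ContinuousOn (fun z : ℍ => (thetaFEPair z).Λ (σ : ℂ)) {z : ℍ | 1 ≤ z.im ∧ z.im ≤ Y} := by
  have hσ0 : (σ : ℂ) ≠ 0 := by exact_mod_cast h0.ne'
  have hσ1 : (σ : ℂ) ≠ 1 := by exact_mod_cast h1.ne
  have hσh : (σ : ℂ) ≠ 1 / 2 := by
    intro h
    have h' := congrArg Complex.re h
    simp at h'
    exact hh (by rw [h']; norm_num)
  have hE := continuousOn_epsteinBesselPart (s := (σ : ℂ)) (by simp; exact h0.le)
    (by simp; exact h1.le) Y
  have him : Continuous fun z : ℍ => z.im := UpperHalfPlane.continuous_im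
  have hA : Continuous fun z : ℍ => ((z.im ^ σ : ℝ) : ℂ) :=
    Complex.continuous_ofReal.comp (him.rpow_const fun z => Or.inl z.im_pos.ne')
  have hB : Continuous fun z : ℍ => ((z.im ^ (1 - σ) : ℝ) : ℂ) :=
    Complex.continuous_ofReal.comp (him.rpow_const fun z => Or.inl z.im_pos.ne')
  have hG : ContinuousOn (fun z : ℍ => 2 * ((z.im ^ σ : ℝ) : ℂ) * completedRiemannZeta (2 * (σ : ℂ)) +
      2 * ((z.im ^ (1 - σ) : ℝ) : ℂ) * completedRiemannZeta (2 - 2 * (σ : ℂ)) +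
      epsteinBesselPart z σ) {z : ℍ | 1 ≤ z.im ∧ z.im ≤ Y} :=
    (((continuousOn_const.mul hA.continuousOn).mul continuousOn_const).add
      ((continuousOn_const.mul hB.continuousOn).mul continuousOn_const)).add hE
  refine hG.congr fun z hz => ?_
  have hy0 : 0 ≤ z.im := z.im_pos.le
  rw [Λ_eq_constantTerm_add_besselPart z hz.1 hσ0 hσ1 hσh,
    show (1 : ℂ) - (σ : ℂ) = ((1 - σ : ℝ) : ℂ) by push_cast; ring,
    ← Complex.ofReal_cpow hy0, ← Complex.ofReal_cpow hy0]

/-! ## The sign of `Λ_z(β)` at the two ends of the family -/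

/-- **`Λ_z(β) > 0` at a large height**: for `β ∈ (½, 1)` there is `Y ≥ 50` such that
`Re Λ_z(β) > 0` whenever `Im z = Y` (`2Y^βA − 2Y^{1−β}B − 2 > 0` with `A = 1/(2β−1) − 1/(2β)`,
`B = 1/(2−2β) + 1/(2β−1)`, once `Y^{2β−1} ≥ 2(B+1)/A`). [folklore] -/
theorem exists_im_re_thetaΛ_pos {β : ℝ} (hβ : 1 / 2 < β) (hβ1 : β < 1) :
    ∃ Y : ℝ, 50 ≤ Y ∧ ∀ z : ℍ, z.im = Y → 0 < ((thetaFEPair z).Λ (β : ℂ)).re := by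
  set A : ℝ := -(1 / (2 * β)) + 1 / (2 * β - 1) with hA
  set B : ℝ := 1 / (2 - 2 * β) + 1 / (2 * β - 1) with hB
  have hA0 : 0 < A := by
    have h1 : 1 / (2 * β) < 1 / (2 * β - 1) := one_div_lt_one_div_of_lt (by linarith) (by linarith)
    rw [hA]; linarith
  have hB0 : 0 < B := by
    have h1 := one_div_pos.2 (by linarith : (0 : ℝ) < 2 - 2 * β)
    have h2 := one_div_pos.2 (by linarith : (0 : ℝ) < 2 * β - 1)
    rw [hB]; linarith
  -- choose the height
  have hev : ∀ᶠ Y : ℝ in atTop, 2 * (B + 1) / A ≤ Y ^ (2 * β - 1) ∧ 50 ≤ Y :=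
    ((tendsto_rpow_atTop (by linarith : (0 : ℝ) < 2 * β - 1)).eventually_ge_atTop _).and
      (eventually_ge_atTop 50)
  obtain ⟨Y, hYpow, hY50⟩ := hev.exists
  refine ⟨Y, hY50, fun z hzY => ?_⟩
  have hY0 : 0 < Y := by linarith
  have hy1 : 1 ≤ z.im := by rw [hzY]; linarith
  have hβ0 : 0 < β := by linarith
  -- the decomposition at `s = β`
  have h0 : (β : ℂ) ≠ 0 := by exact_mod_cast hβ0.ne'
  have h1 : (β : ℂ) ≠ 1 := by exact_mod_cast hβ1.ne
  have hh : (β : ℂ) ≠ 1 / 2 := by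
    intro h
    have h' := congrArg Complex.re h
    simp at h'
    rw [h'] at hβ
    norm_num at hβ
  have hdec := Λ_eq_constantTerm_add_besselPart z hy1 h0 h1 hh
  have eA : (2 * ((z.im : ℝ) : ℂ) ^ (β : ℂ) * completedRiemannZeta (2 * (β : ℂ))).re =
      2 * Y ^ β * (completedRiemannZeta ((2 * β : ℝ) : ℂ)).re := by
    rw [hzY, show (2 : ℂ) * (β : ℂ) = ((2 * β : ℝ) : ℂ) by push_cast; ring,
      ← Complex.ofReal_cpow hY0.le,
      show (2 : ℂ) * ((Y ^ β : ℝ) : ℂ) = ((2 * Y ^ β : ℝ) : ℂ) by push_cast; ring,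
      Complex.re_ofReal_mul]
  have eB : (2 * ((z.im : ℝ) : ℂ) ^ (1 - (β : ℂ)) * completedRiemannZeta (2 - 2 * (β : ℂ))).re =
      2 * Y ^ (1 - β) * (completedRiemannZeta ((2 - 2 * β : ℝ) : ℂ)).re := by
    rw [hzY, show (2 : ℂ) - 2 * (β : ℂ) = ((2 - 2 * β : ℝ) : ℂ) by push_cast; ring,
      show (1 : ℂ) - (β : ℂ) = ((1 - β : ℝ) : ℂ) by push_cast; ring, ← Complex.ofReal_cpow hY0.le,
      show (2 : ℂ) * ((Y ^ (1 - β) : ℝ) : ℂ) = ((2 * Y ^ (1 - β) : ℝ) : ℂ) by push_cast; ring,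
      Complex.re_ofReal_mul]
  -- the completed zeta values
  have hLA : A ≤ (completedRiemannZeta ((2 * β : ℝ) : ℂ)).re := by
    have h := re_completedRiemannZeta_ge_of_one_lt (u := 2 * β) (by linarith)
    rw [hA]; exact h
  have hLB : -B ≤ (completedRiemannZeta ((2 - 2 * β : ℝ) : ℂ)).re := by
    have h := re_completedRiemannZeta_ge_of_lt_one (u := 2 - 2 * β) (by linarith) (by linarith)
    have e : (1 : ℝ) - (2 - 2 * β) = 2 * β - 1 := by ring
    rw [e] at h
    rw [hB]; linarith
  -- the Bessel part: `|E_z(β)| ≤ 2`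
  have hC : -2 ≤ (epsteinBesselPart z β).re := by
    have hn := norm_epsteinBesselPart_le z hy1 (s := (β : ℂ)) (by simp; linarith) (by simp; linarith)
    have hre : -‖epsteinBesselPart z β‖ ≤ (epsteinBesselPart z β).re :=
      (abs_le.1 (Complex.abs_re_le_norm _)).1
    set y := z.im with hydef
    have hy0 : 0 < y := by linarith
    have hy49 : 49 ≤ y := by linarith [hzY, hY50]
    have hexp : Real.exp (-(7 / 5) * Real.pi * y) ≤ 1 / (4 * y + 1) := by
      have h1 : Real.exp (-(7 / 5) * Real.pi * y) ≤ Real.exp (-(4 * y)) :=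
        Real.exp_le_exp.2 (by nlinarith [Real.pi_gt_three])
      have h2 := Real.add_one_le_exp (4 * y)
      have h3 : Real.exp (-(4 * y)) ≤ 1 / (4 * y + 1) := by
        rw [Real.exp_neg, inv_eq_one_div]
        exact one_div_le_one_div_of_le (by positivity) h2
      exact h1.trans h3
    have hs7 : 7 ≤ Real.sqrt y := (Real.le_sqrt' (by norm_num)).2 (by linarith)
    have hsq : Real.sqrt y ^ 2 = y := Real.sq_sqrt hy0.le
    have hbound : 48 * Real.sqrt y * Real.exp (-(7 / 5) * Real.pi * y) ≤ 2 := by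
      calc 48 * Real.sqrt y * Real.exp (-(7 / 5) * Real.pi * y)
          ≤ 48 * Real.sqrt y * (1 / (4 * y + 1)) := mul_le_mul_of_nonneg_left hexp (by positivity)
        _ = 48 * Real.sqrt y / (4 * y + 1) := by ring
        _ ≤ 2 := by
            rw [div_le_iff₀ (by positivity)]
            nlinarith
    linarith
  -- powers of `Y`
  have hYβ : 0 < Y ^ β := Real.rpow_pos_of_pos hY0 β
  have hY1β : 1 ≤ Y ^ (1 - β) := Real.one_le_rpow (by linarith) (by linarith)
  have hsplit : Y ^ β = Y ^ (1 - β) * Y ^ (2 * β - 1) := by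
    rw [← Real.rpow_add hY0]; congr 1; ring
  -- the main inequality `2Y^{1−β}B + 2 < 2Y^βA`
  have hmain : 2 * Y ^ (1 - β) * B + 2 < 2 * Y ^ β * A := by
    have hK : 2 * (B + 1) / A ≤ Y ^ (2 * β - 1) := hYpow
    rw [div_le_iff₀ hA0] at hK
    have hY1β0 : 0 ≤ Y ^ (1 - β) := by linarith
    have hprod := mul_le_mul_of_nonneg_left hK hY1β0
    rw [hsplit]
    nlinarith
  have t1 : 2 * Y ^ β * A ≤ 2 * Y ^ β * (completedRiemannZeta ((2 * β : ℝ) : ℂ)).re :=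
    mul_le_mul_of_nonneg_left hLA (by positivity)
  have t2 : 2 * Y ^ (1 - β) * (-B) ≤ 2 * Y ^ (1 - β) * (completedRiemannZeta ((2 - 2 * β : ℝ) : ℂ)).re :=
    mul_le_mul_of_nonneg_left hLB (by positivity)
  rw [hdec, Complex.add_re, Complex.add_re, eA, eB]
  linarith

/-! ## The vertical path `y ↦ iy` and the intermediate value theorem -/

/-- The path `y ↦ i·max(y, 1)` into `ℍ` is continuous. [folklore] -/
theorem continuous_vertPath :
    Continuous fun y : ℝ => (⟨⟨0, max y 1⟩, lt_max_of_lt_right one_pos⟩ : ℍ) := by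
  refine UpperHalfPlane.isEmbedding_coe.continuous_iff.2 ?_
  have e : ((↑) : ℍ → ℂ) ∘ (fun y : ℝ => (⟨⟨0, max y 1⟩, lt_max_of_lt_right one_pos⟩ : ℍ)) =
      fun y : ℝ => ((max y 1 : ℝ) : ℂ) * Complex.I := by
    funext y
    apply Complex.ext
    · show (0 : ℝ) = _
      simp
    · show max y 1 = _
      simp
  rw [e]
  exact (Complex.continuous_ofReal.comp (continuous_id.max continuous_const)).mul continuous_const

/-- The path has `Im = y` for `y ≥ 1`. [folklore] -/
theorem vertPath_im {y : ℝ} (hy : 1 ≤ y) :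
    (⟨⟨0, max y 1⟩, lt_max_of_lt_right one_pos⟩ : ℍ).im = y := by
  show max y 1 = y
  exact max_eq_left hy

/-- The path has `Re = 0`. [folklore] -/
theorem vertPath_re (y : ℝ) : (⟨⟨0, max y 1⟩, lt_max_of_lt_right one_pos⟩ : ℍ).re = 0 := rfl

/-- **A zero of `Λ_{iy}(β)` in `y ∈ (1, ∞)` for every `β ∈ (½, 1)`** (intermediate value theorem
between `y = 1`, where `Λ < 0`, and the height of `exists_im_re_thetaΛ_pos`). [folklore] -/
theorem exists_Λ_eq_zero_of_half_lt {β : ℝ} (hβ : 1 / 2 < β) (hβ1 : β < 1) :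
    ∃ y : ℝ, 1 < y ∧ ∀ z : ℍ, z.re = 0 → z.im = y → (thetaFEPair z).Λ (β : ℂ) = 0 := by
  obtain ⟨Y, hY50, hpos⟩ := exists_im_re_thetaΛ_pos hβ hβ1
  set γ : ℝ → ℍ := fun y => ⟨⟨0, max y 1⟩, lt_max_of_lt_right one_pos⟩ with hγ
  set G : ℝ → ℝ := fun y => ((thetaFEPair (γ y)).Λ (β : ℂ)).re with hG
  have hβ0 : 0 < β := by linarith
  have hcontΛ := continuousOn_thetaΛ_ofReal hβ0 hβ1 hβ.ne' Y
  have hmaps : MapsTo γ (Icc 1 Y) {z : ℍ | 1 ≤ z.im ∧ z.im ≤ Y} := fun y hy => by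
    show 1 ≤ (γ y).im ∧ (γ y).im ≤ Y
    rw [show (γ y).im = y from vertPath_im hy.1]
    exact hy
  have hcont : ContinuousOn G (Icc 1 Y) :=
    Complex.continuous_re.comp_continuousOn (hcontΛ.comp continuous_vertPath.continuousOn hmaps)
  have h1 : G 1 < 0 := by
    have him1 : (γ 1).im = 1 := vertPath_im le_rfl
    exact re_thetaΛ_neg_of_im_le_one (γ 1) (by rw [him1]; norm_num) (by rw [him1]) hβ0 hβ1
  have h2 : 0 < G Y := hpos (γ Y) (vertPath_im (by linarith))
  obtain ⟨y, hy, hGy⟩ := intermediate_value_Icc (by linarith : (1 : ℝ) ≤ Y) hcont ⟨h1.le, h2.le⟩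
  have hy1 : 1 < y := lt_of_le_of_ne hy.1 fun h => by
    rw [← h] at hGy; linarith
  refine ⟨y, hy1, fun z hre him => ?_⟩
  have hz : z = γ y := by
    apply UpperHalfPlane.ext
    apply Complex.ext
    · show z.re = (γ y).re
      rw [hre, vertPath_re]
    · show z.im = (γ y).im
      rw [him, vertPath_im hy.1]
  rw [hz]
  apply Complex.ext
  · rw [Complex.zero_re]
    exact hGy
  · rw [im_Λ_ofReal, Complex.zero_im]

/-! ## The forms -/

/-- Stark's parameter of `x² + y²·(y')²`: `k(1, 0, y²) = y` for `y > 0`. [folklore] -/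
theorem starkK_one_zero_sq {y : ℝ} (hy : 0 < y) : starkK 1 0 (y ^ 2) = y := by
  rw [starkK_one, show (4 : ℝ) * y ^ 2 - 0 ^ 2 = (2 * y) ^ 2 by ring, Real.sqrt_sq (by linarith)]
  ring

/-- **Every `β ∈ (½, 1)` is a zero of some member of the family**: there is `c > 1` (Stark's
`k = √c > 1`) such that every analytic continuation of the Epstein zeta function of `x² + cy²`
vanishes at `β`. [cite: Stark1967EpsteinZeros, Theorem 1 and §4] [cite: BeterminSamajTravenec2021, §4.2] -/
theorem exists_form_realZero_of_half_lt {β : ℝ} (hβ : 1 / 2 < β) (hβ1 : β < 1) :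
    ∃ c : ℝ, 1 < c ∧ IsPosDefForm 1 0 c ∧
      ∀ Z : ℂ → ℂ, IsEpsteinContinuation 1 0 c Z → Z β = 0 := by
  obtain ⟨y, hy1, hΛ⟩ := exists_Λ_eq_zero_of_half_lt hβ hβ1
  have hy0 : 0 < y := by linarith
  have h : IsPosDefForm 1 0 (y ^ 2) := ⟨one_pos, by nlinarith⟩
  have hk := starkK_one_zero_sq hy0
  refine ⟨y ^ 2, by nlinarith, h, fun Z hZ => ?_⟩
  obtain ⟨z, hre, him, hk'⟩ := exists_zQ' h
  have hZ' : IsEpsteinContinuation (y ^ 2) 0 1 Z := (isEpsteinContinuation_swap_iff 1 0 (y ^ 2) Z).2 hZ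
  have e := continuation_ofReal_eq h.swap z hre him hZ' (σ := β) (by linarith) hβ1
  rw [e, hΛ z (by rw [hre]; simp) (by rw [hk', hk]), mul_zero]

/-- **Every `β ∈ (0, ½)` is a zero of some member of the family** (from `(½, 1)` by the functional
equation `Λ_z(1 − s) = Λ_z(s)`). [cite: MontgomeryVaughan2007, §10.1 Exercise 25 (e)] -/
theorem exists_form_realZero_of_lt_half {β : ℝ} (hβ0 : 0 < β) (hβ : β < 1 / 2) :
    ∃ c : ℝ, 1 < c ∧ IsPosDefForm 1 0 c ∧
      ∀ Z : ℂ → ℂ, IsEpsteinContinuation 1 0 c Z → Z β = 0 := by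
  obtain ⟨y, hy1, hΛ⟩ := exists_Λ_eq_zero_of_half_lt (β := 1 - β) (by linarith) (by linarith)
  have hy0 : 0 < y := by linarith
  have h : IsPosDefForm 1 0 (y ^ 2) := ⟨one_pos, by nlinarith⟩
  have hk := starkK_one_zero_sq hy0
  refine ⟨y ^ 2, by nlinarith, h, fun Z hZ => ?_⟩
  obtain ⟨z, hre, him, hk'⟩ := exists_zQ' h
  have hZ' : IsEpsteinContinuation (y ^ 2) 0 1 Z := (isEpsteinContinuation_swap_iff 1 0 (y ^ 2) Z).2 hZ
  have e := continuation_ofReal_eq h.swap z hre him hZ' (σ := β) hβ0 (by linarith)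
  have hΛβ : (thetaFEPair z).Λ (β : ℂ) = 0 := by
    rw [show (β : ℂ) = 1 - ((1 - β : ℝ) : ℂ) by push_cast; ring, thetaFEPair_Λ_one_sub]
    exact hΛ z (by rw [hre]; simp) (by rw [hk', hk])
  rw [e, hΛβ, mul_zero]

/-- **The real zeros of the Epstein zeta functions of positive definite binary forms fill `(0, 1)`**
(barrier audit, generation 7): for every `β ∈ (0, 1)` there is `c > 1` such that every analytic
continuation `Z` of the Epstein zeta function of `x² + cy²` satisfies `Z(β) = 0` (`β = ½`:
`EpsteinZetaCentralZero.exists_form_central_zero`, a double zero). Hence no zero-free real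
sub-interval of the critical strip for `ζ_K = ζ·L(s, χ_d)` — in particular neither the absence of
the exceptional zero nor `L(½, χ_d) ≠ 0` — follows from properties shared by all `ζ_Q`.
[cite: BatemanGrosswald1964, Theorem 3] [cite: Stark1967EpsteinZeros, Theorem 1 and §4] [cite: BeterminSamajTravenec2021, §4.2] -/
theorem realZeros_fill_unit_interval {β : ℝ} (hβ0 : 0 < β) (hβ1 : β < 1) :
    ∃ c : ℝ, 1 < c ∧ IsPosDefForm 1 0 c ∧
      ∀ Z : ℂ → ℂ, IsEpsteinContinuation 1 0 c Z → Z β = 0 := by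
  rcases lt_trichotomy β (1 / 2) with hlt | heq | hgt
  · exact exists_form_realZero_of_lt_half hβ0 hlt
  · subst heq
    obtain ⟨c, h1, -, h, -, -, hZ⟩ := exists_form_central_zero
    refine ⟨c, by nlinarith, h, fun Z hZc => ?_⟩
    have hhalf : ((1 / 2 : ℝ) : ℂ) = 1 / 2 := by push_cast; rfl
    rw [hhalf]
    exact hZ Z hZc
  · exact exists_form_realZero_of_half_lt hgt hβ1

/-- **The same in the `(½, 1)` half with Stark's normalisation** (`k = √c`): for every
`β ∈ (½, 1)` some form with `k > 1` has ALL its continuations vanishing at `β` — Bateman–Grosswald's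
"a real zero between `½` and `1`" realised at every prescribed position.
[cite: BatemanGrosswald1964, Theorem 3 and p. 367] -/
theorem exists_starkK_realZero_at {β : ℝ} (hβ : 1 / 2 < β) (hβ1 : β < 1) :
    ∃ c : ℝ, IsPosDefForm 1 0 c ∧ 1 < starkK 1 0 c ∧
      ∀ Z : ℂ → ℂ, IsEpsteinContinuation 1 0 c Z → Z β = 0 := by
  obtain ⟨y, hy1, hΛ⟩ := exists_Λ_eq_zero_of_half_lt hβ hβ1
  have hy0 : 0 < y := by linarith
  have h : IsPosDefForm 1 0 (y ^ 2) := ⟨one_pos, by nlinarith⟩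
  have hk := starkK_one_zero_sq hy0
  refine ⟨y ^ 2, h, by rw [hk]; exact hy1, fun Z hZ => ?_⟩
  obtain ⟨z, hre, him, hk'⟩ := exists_zQ' h
  have hZ' : IsEpsteinContinuation (y ^ 2) 0 1 Z := (isEpsteinContinuation_swap_iff 1 0 (y ^ 2) Z).2 hZ
  have e := continuation_ofReal_eq h.swap z hre him hZ' (σ := β) (by linarith) hβ1
  rw [e, hΛ z (by rw [hre]; simp) (by rw [hk', hk]), mul_zero]

end Literature.Barriers.RiemannHypothesis
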